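import Literature.MathematicalPhysics.QuantumFieldTheory.WilsonFinTorusMagneticSliceKernel
import Literature.MathematicalPhysics.QuantumFieldTheory.TwistedPartitionFunction
import HarnessLib

/-!
# 't Hooft's single-plane twisted partition function on the ANISOTROPIC four-torus `L_s³ × L_t`

Definition request `defn-AnisotropicTwistedPartitionFunction` (route `VortexVolumeRatchet` of
`QuantumFields/YangMills`, rung 2: time-doubling monotonicity of the vortex ratio `t_z(L_s, L_t)` at fixed
spatial side).  The symmetric-torus object `twistedPartitionFunction ρ β L z q` (`TwistedPartitionFunction.lean`:
sites `Fin 4 → ZMod L`, the central twist `z` inserted into every plaquette of the plane `q = (μ, ν)` based in the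
stack `{x_μ = 0, x_ν = 0}`, Greensite 2011 §4.4 (4.43)–(4.44)) cannot express independent spatial and temporal
sides.  The anisotropic `Fin`-box formalism of `WilsonFinTorus*.lean` can: 't Hooft's six-twist functional integral
`W{n_{μν}; a_μ} = wilsonFinTorusTensorTwistedPartition ρ β zT n₀ n₁ n₂ n₃` ('t Hooft 1979 §2 (2.5)–(2.6)) on the box
`n₀ × n₁ × n₂ × n₃` (time = the last axis) puts `zT μ ν` on the stack `{x_μ = 0, x_ν = 0}` of EVERY plane.  This file
names the single-plane case on the box `L_s × L_s × L_s × L_t`,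

  `twistedPartitionFunctionAniso ρ β L_s L_t z q := W{planeTwistTensor z q}(L_s, L_s, L_s, L_t)`,
  `planeTwistTensor z q = (z in the entry q = (μ, ν), 1 elsewhere)`,

and PROVES the dictionary both ways:

* `twistedPartitionFunctionAniso_eq_integral` — the defining Wilson integral written out: the twist `z` multiplies
  exactly the plaquettes `(x; μ, ν)` of the plane `q` with `x_μ = 0 = x_ν` (all values of the two other coordinates);
* ★ `twistedPartitionFunctionAniso_self` — **equal sides give back the symmetric-torus object**:
  `twistedPartitionFunctionAniso ρ β L L z q = twistedPartitionFunction ρ β L z q` for every `L ≥ 1`, every `z`, `q`,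
  `ρ`, `β` (the link reindexing `finTorusConfigEquivSite` of `WilsonFinTorusPartition.lean` along
  `Fin L ≃ ZMod L`: plaquettes correspond with their orientation, and the stack `{x_μ = 0 = x_ν}` corresponds to itself;
  a change of variables in the product Haar integral, no continuity or centrality needed);
* `twistedPartitionFunctionAniso_one` (no twist = `wilsonFinTorusPartition ρ β L_s L_s L_s L_t`),
  `twistedPartitionFunctionAniso_pos` (`0 < Z`, continuous `ρ`), `twistedPartitionFunctionAniso_beta_zero` (`Z = 1` at
  `β = 0`: non-vacuity);
* `twistedPartitionFunctionAniso_temporal` — for a TEMPORAL plane `q = (μ, 3)` it is the temporally twisted partition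
  function `wilsonFinTorusTwistedPartition ρ β (Pi.mulSingle μ z) L_s L_s L_s L_t` of `WilsonFinTorusTwistedPartition.lean`,
  so that the transfer-matrix∕trace form is AVAILABLE verbatim from the tree: the twisted time slicing
  `wilsonFinTorusTwistedPartition_eq_integral_prod_finTorusSliceKernel` / `…_eq_integral_iterate` (`Z^{(z)} = Tr Ω[z] 𝕋^{L_t}`
  in path space, 't Hooft §5 (5.3)), the electric-flux sectors `wilsonFinTorusFluxPartition` with
  `sum_apply_mul_wilsonFinTorusFluxPartition` (`Z^{(k)} = Σ_e ψ_e(k) e^{−βF(e)}`, (5.4) inverted) and their spectral content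
  `exists_fluxSpectralData_wilsonFinTorus` (vacuum flux-free; Hopf gap of every `e ≠ 0` sector at fixed spatial box) in
  `WilsonFinTorusElectricFluxSectors.lean`;
* `twistedPartitionFunctionAniso_eq_elecMag` — for a SPATIAL plane `q = (i, j)`, `j < 3`, it is the purely MAGNETIC case
  `W{elecMagTwistTensor 1 (planeTwistTensor z q)}` of `WilsonFinTorusMagneticSliceKernel.lean` ∕ `…MagneticFluxSectors.lean`
  (`Tr_m 𝕋_m^{L_t}`).

HONEST FRAMING: two definitions with bodies and reindexing identities; nothing here is an estimate of a twisted
partition function, a statement about vortex free energies, their monotonicity in `L_t` or `L_s`, confinement or a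
mass gap.

References: G. 't Hooft, Nucl. Phys. B 153 (1979) 141, §2 (2.5)–(2.6), §5 (5.3)–(5.4); J. Greensite, *An Introduction
to the Confinement Problem*, LNP 821 (2011) §4.4 (4.41)–(4.44); I. Montvay, G. Münster, *Quantum Fields on a Lattice*
(1994) §3.2.6 (3.145).
-/

noncomputable section

open scoped BigOperators
open MeasureTheory

namespace Literature.MathematicalPhysics.QuantumFieldTheory

/-! ### The single-plane twist tensor -/

section Tensor

variable {G : Type*} [Group G]

/-- **The twist tensor of a single twisted plane**: `z` in the entry `q = (μ, ν)` (`μ < ν`), `1` in every other entry —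
't Hooft's `n_{μν}` with exactly one non-zero component.  Fed to `tHooftTwistTensor` it twists the plaquettes of plane
`q` based in the stack `{x_μ = 0, x_ν = 0}` (Greensite's one coclosed stack, (4.43)).
[cite: tHooft1979Flux, §2 (2.5)–(2.6)] [cite: Greensite2011, §4.4 (4.41)–(4.43)] -/
def planeTwistTensor (z : G) (q : {p : Fin 4 × Fin 4 // p.1 < p.2}) : Fin 4 → Fin 4 → G :=
  fun μ ν => if μ = q.1.1 ∧ ν = q.1.2 then z else 1

/-- The twisted entry. [cite: tHooft1979Flux, §2 (2.5)] -/
@[simp] theorem planeTwistTensor_self (z : G) (q : {p : Fin 4 × Fin 4 // p.1 < p.2}) :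
    planeTwistTensor z q q.1.1 q.1.2 = z := by
  simp [planeTwistTensor]

/-- The untwisted entries. [cite: tHooft1979Flux, §2 (2.5)] -/
theorem planeTwistTensor_of_ne (z : G) (q : {p : Fin 4 × Fin 4 // p.1 < p.2}) {μ ν : Fin 4}
    (h : ¬(μ = q.1.1 ∧ ν = q.1.2)) : planeTwistTensor z q μ ν = 1 := by
  simp [planeTwistTensor, h]

/-- No twist: the tensor of `z = 1` is `1`. [cite: tHooft1979Flux, §2 (2.5)] -/
@[simp] theorem planeTwistTensor_one (q : {p : Fin 4 × Fin 4 // p.1 < p.2}) :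
    planeTwistTensor (1 : G) q = 1 := by
  funext μ ν
  simp [planeTwistTensor]

/-- 't Hooft's stack tensor of a single-plane twist, on an ordered pair `μ < ν`: `z` iff `(μ, ν) = q` and the base point
lies in the stack `{x_μ = 0, x_ν = 0}`. [cite: tHooft1979Flux, §2 (2.5)–(2.6)] [cite: Greensite2011, §4.4 (4.43)] -/
theorem tHooftTwistTensor_planeTwistTensor (z : G) (q : {p : Fin 4 × Fin 4 // p.1 < p.2}) {n₀ n₁ n₂ n₃ : ℕ}
    (x : FinTorusSite n₀ n₁ n₂ n₃) (μ ν : Fin 4) :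
    tHooftTwistTensor (planeTwistTensor z q) x μ ν =
      if (μ = q.1.1 ∧ ν = q.1.2) ∧ finTorusSiteCoord x q.1.1 = 0 ∧ finTorusSiteCoord x q.1.2 = 0 then z else 1 := by
  unfold tHooftTwistTensor planeTwistTensor
  by_cases hq : μ = q.1.1 ∧ ν = q.1.2
  · obtain ⟨rfl, rfl⟩ := hq
    by_cases hc : finTorusSiteCoord x q.1.1 = 0 ∧ finTorusSiteCoord x q.1.2 = 0 <;> simp [hc]
  · simp [hq]

/-- A temporal single-plane twist `q = (μ, 3)` is the temporal family `Pi.mulSingle μ z` of the companion files.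
[cite: tHooft1979Flux, §2 (2.5)] -/
theorem planeTwistTensor_eq_temporalTwistTensor (z : G) (q : {p : Fin 4 × Fin 4 // p.1 < p.2}) (hq : q.1.2 = 3) :
    planeTwistTensor z q = temporalTwistTensor (Pi.mulSingle q.1.1 z) := by
  funext μ ν
  unfold planeTwistTensor temporalTwistTensor
  rw [hq]
  by_cases hν : ν = 3
  · subst hν
    by_cases hμ : μ = q.1.1
    · subst hμ; simp
    · simp [hμ]
  · simp [hν]

/-- A spatial single-plane twist `q = (i, j)`, `j ≠ 3`, has no electric part: it is `elecMagTwistTensor 1 (planeTwistTensor z q)`.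
[cite: tHooft1979Flux, §2 (2.5)] -/
theorem planeTwistTensor_eq_elecMagTwistTensor (z : G) (q : {p : Fin 4 × Fin 4 // p.1 < p.2}) (hq : q.1.2 ≠ 3) :
    planeTwistTensor z q = elecMagTwistTensor 1 (planeTwistTensor z q) := by
  funext μ ν
  unfold elecMagTwistTensor
  by_cases hν : ν = 3
  · subst hν
    have h : ¬(μ = q.1.1 ∧ (3 : Fin 4) = q.1.2) := fun h => hq h.2.symm
    simp [planeTwistTensor_of_ne z q h]
  · simp [hν]

end Tensor

/-! ### The anisotropic single-plane twisted partition function -/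

section Defs

variable {G : Type*} [Group G] {N : ℕ} (ρ : G →* Matrix (Fin N) (Fin N) ℂ) [TopologicalSpace G]
  [IsTopologicalGroup G] [CompactSpace G] [MeasurableSpace G] [BorelSpace G]

/-- **'t Hooft's twisted partition function of the anisotropic four-torus `L_s × L_s × L_s × L_t`** (time = the last
axis) with the twist `z` (central in every use) in the single plane `q = (μ, ν)`:
`Z_{β}(z; q; L_s, L_t) = ∫ ∏ₗ dU_l exp(−β Σ_x Σ_{μ'<ν'} (N − Re tr ρ(t_z(x; μ', ν') U_{x,μ'ν'})))`, `t_z = z` exactly on the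
plaquettes of plane `q` whose base point has `x_μ = 0 = x_ν`, `1` otherwise — the single-plane case of the six-twist
functional integral `W{n_{μν}; a_μ} = wilsonFinTorusTensorTwistedPartition` with `a = (L_s, L_s, L_s, L_t)`.  For
`L_s = L_t = L` it is the symmetric-torus `twistedPartitionFunction ρ β L z q` (`twistedPartitionFunctionAniso_self`).
[cite: tHooft1979Flux, §2 (2.5)–(2.6)] [cite: Greensite2011, §4.4 (4.43)–(4.44)] -/
def twistedPartitionFunctionAniso (β : ℝ) (Ls Lt : ℕ) (z : G) (q : {p : Fin 4 × Fin 4 // p.1 < p.2}) : ℝ :=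
  wilsonFinTorusTensorTwistedPartition ρ β (planeTwistTensor z q) Ls Ls Ls Lt

/-- Unfolding: the anisotropic twisted partition function is `W{planeTwistTensor z q}(L_s, L_s, L_s, L_t)`.
[cite: tHooft1979Flux, §2 (2.6)] -/
theorem twistedPartitionFunctionAniso_def (β : ℝ) (Ls Lt : ℕ) (z : G) (q : {p : Fin 4 × Fin 4 // p.1 < p.2}) :
    twistedPartitionFunctionAniso ρ β Ls Lt z q =
      wilsonFinTorusTensorTwistedPartition ρ β (planeTwistTensor z q) Ls Ls Ls Lt := rfl

/-- **The defining Wilson integral, written out**: the twist multiplies exactly the plaquettes `(x; μ, ν) = (x; q)` with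
`x_μ = 0` and `x_ν = 0`. [cite: tHooft1979Flux, §2 (2.6)] [cite: Greensite2011, §4.4 (4.43)–(4.44)] -/
theorem twistedPartitionFunctionAniso_eq_integral (β : ℝ) (Ls Lt : ℕ) (z : G)
    (q : {p : Fin 4 × Fin 4 // p.1 < p.2}) :
    twistedPartitionFunctionAniso ρ β Ls Lt z q =
      ∫ U, Real.exp (-β * ∑ x : FinTorusSite Ls Ls Ls Lt, ∑ q' : {p : Fin 4 × Fin 4 // p.1 < p.2},
          ((N : ℝ) - (ρ ((if q' = q ∧ finTorusSiteCoord x q.1.1 = 0 ∧ finTorusSiteCoord x q.1.2 = 0 then z else 1) *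
            finTorusPlaquette U x q'.1.1 q'.1.2)).trace.re))
        ∂(Measure.pi fun _ : FinTorusSite Ls Ls Ls Lt × Fin 4 => haarProbability G) := by
  unfold twistedPartitionFunctionAniso wilsonFinTorusTensorTwistedPartition wilsonFinTorusPlaqTwistedPartition
  refine integral_congr_ae (ae_of_all _ fun U => ?_)
  simp only
  congr 1; congr 1
  refine Finset.sum_congr rfl fun x _ => Finset.sum_congr rfl fun q' _ => ?_
  have hiff : (q'.1.1 = q.1.1 ∧ q'.1.2 = q.1.2) ↔ q' = q := by
    rw [Subtype.ext_iff, Prod.ext_iff]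
  rw [tHooftTwistTensor_planeTwistTensor]
  simp only [hiff]

/-- **No twist is Wilson's partition function of the anisotropic box.** [cite: tHooft1979Flux, §2 (2.6)] -/
theorem twistedPartitionFunctionAniso_one (β : ℝ) (Ls Lt : ℕ) (q : {p : Fin 4 × Fin 4 // p.1 < p.2}) :
    twistedPartitionFunctionAniso ρ β Ls Lt (1 : G) q = wilsonFinTorusPartition ρ β Ls Ls Ls Lt := by
  rw [twistedPartitionFunctionAniso, planeTwistTensor_one,
    show (1 : Fin 4 → Fin 4 → G) = temporalTwistTensor (1 : Fin 4 → G) from by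
      funext μ ν; simp [temporalTwistTensor],
    wilsonFinTorusTensorTwistedPartition_temporal, wilsonFinTorusTwistedPartition_one]

/-- **Non-vacuity: at `β = 0` the anisotropic twisted partition function equals `1`** for every box, twist and plane
(the product of the normalised Haar measures of (4.44) is a probability measure). [cite: Greensite2011, §4.4 (4.44)] -/
theorem twistedPartitionFunctionAniso_beta_zero (Ls Lt : ℕ) (z : G) (q : {p : Fin 4 × Fin 4 // p.1 < p.2}) :
    twistedPartitionFunctionAniso ρ 0 Ls Lt z q = 1 := by
  simp only [twistedPartitionFunctionAniso, wilsonFinTorusTensorTwistedPartition_def,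
    wilsonFinTorusPlaqTwistedPartition, neg_zero, zero_mul, Real.exp_zero, integral_const, probReal_univ, one_smul]

/-- **The anisotropic twisted partition function is strictly positive** (continuous `ρ`; a positive continuous
integrand against a probability measure). [cite: tHooft1979Flux, §2 (2.6)] -/
theorem twistedPartitionFunctionAniso_pos [SecondCountableTopology G] (hρ : Continuous ρ) (β : ℝ) (Ls Lt : ℕ)
    (z : G) (q : {p : Fin 4 × Fin 4 // p.1 < p.2}) : 0 < twistedPartitionFunctionAniso ρ β Ls Lt z q :=
  wilsonFinTorusTensorTwistedPartition_pos ρ hρ β _ Ls Ls Ls Lt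

/-- **Temporal planes: the transfer-matrix reading is available.**  For `q = (μ, 3)` the anisotropic twisted partition
function is the TEMPORALLY twisted partition function of `WilsonFinTorusTwistedPartition.lean` with the twist family
`Pi.mulSingle μ z` — hence, for central `z`, `Z^{(z)}(L_s, L_t) = Tr Ω[z] 𝕋(L_s)^{L_t}` in path space
(`wilsonFinTorusTwistedPartition_eq_integral_prod_finTorusSliceKernel`, `…_eq_integral_iterate`) and the electric-flux
decomposition `Z^{(k)} = Σ_e ψ_e(k) e^{−βF(e)}` with its spectral gap data
(`sum_apply_mul_wilsonFinTorusFluxPartition`, `exists_fluxSpectralData_wilsonFinTorus`) apply verbatim.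
[cite: tHooft1979Flux, §5 (5.3)–(5.4)] -/
theorem twistedPartitionFunctionAniso_temporal (β : ℝ) (Ls Lt : ℕ) (z : G) (q : {p : Fin 4 × Fin 4 // p.1 < p.2})
    (hq : q.1.2 = 3) :
    twistedPartitionFunctionAniso ρ β Ls Lt z q =
      wilsonFinTorusTwistedPartition ρ β (Pi.mulSingle q.1.1 z) Ls Ls Ls Lt := by
  rw [twistedPartitionFunctionAniso, planeTwistTensor_eq_temporalTwistTensor z q hq,
    wilsonFinTorusTensorTwistedPartition_temporal]

/-- **Spatial planes: the purely magnetic case.**  For `q = (i, j)` with `j ≠ 3` the anisotropic twisted partition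
function is `W{elecMagTwistTensor 1 (planeTwistTensor z q)}(L_s, L_s, L_s, L_t)` — no electric twist, magnetic twist `z`
in the plane `(i, j)` — the object sliced as `Tr_m 𝕋_m^{L_t}` in `WilsonFinTorusMagneticSliceKernel.lean`.
[cite: tHooft1979Flux, §2 (2.5) and §5 (5.1)] -/
theorem twistedPartitionFunctionAniso_eq_elecMag (β : ℝ) (Ls Lt : ℕ) (z : G) (q : {p : Fin 4 × Fin 4 // p.1 < p.2})
    (hq : q.1.2 ≠ 3) :
    twistedPartitionFunctionAniso ρ β Ls Lt z q =
      wilsonFinTorusTensorTwistedPartition ρ β (elecMagTwistTensor 1 (planeTwistTensor z q)) Ls Ls Ls Lt := by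
  rw [twistedPartitionFunctionAniso, ← planeTwistTensor_eq_elecMagTwistTensor z q hq]

end Defs

/-! ### Equal sides: the symmetric-torus twisted partition function -/

section Symmetric

variable {G : Type*} [Group G] {N : ℕ} (ρ : G →* Matrix (Fin N) (Fin N) ℂ) [TopologicalSpace G]
  [IsTopologicalGroup G] [CompactSpace G] [MeasurableSpace G] [BorelSpace G] {L : ℕ} [NeZero L]

omit [TopologicalSpace G] [IsTopologicalGroup G] [CompactSpace G] [MeasurableSpace G] [BorelSpace G] [Group G] in
/-- The stack corresponds to itself under `Fin L ≃ ZMod L`: the `μ`-th `ZMod` coordinate of the reindexed site vanishes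
iff the `μ`-th `Fin` coordinate (read in `ℕ`) does. [folklore] -/
private theorem finTorusSiteEquivSite_apply_eq_zero_iff (x : FinTorusSite L L L L) (μ : Fin 4) :
    finTorusSiteEquivSite L x μ = 0 ↔ finTorusSiteCoord x μ = 0 := by
  have key : ∀ a : Fin L, (ZMod.finEquiv L a = 0 ↔ (a : ℕ) = 0) := fun a => by
    rw [EmbeddingLike.map_eq_zero_iff, Fin.ext_iff, Fin.val_zero]
  fin_cases μ <;> simp [finTorusSiteEquivSite, finTorusSiteCoord, key]

omit [TopologicalSpace G] [IsTopologicalGroup G] [CompactSpace G] [MeasurableSpace G] [BorelSpace G] in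
/-- The twisted Wilson exponent of the reindexed configuration is the symmetric-torus twisted exponent. [folklore] -/
private theorem sum_twisted_finTorusPlaquette_comp_site (z : G) (q : {p : Fin 4 × Fin 4 // p.1 < p.2})
    (U : GaugeConfig 4 L G) :
    ∑ x : FinTorusSite L L L L, ∑ q' : {p : Fin 4 × Fin 4 // p.1 < p.2},
        ((N : ℝ) - (ρ (tHooftTwistTensor (planeTwistTensor z q) x q'.1.1 q'.1.2 *
          finTorusPlaquette (fun l => U (finTorusSiteEquivSite L l.1, l.2)) x q'.1.1 q'.1.2)).trace.re) =
      ∑ p : Plaquette 4 L, ((N : ℝ) - (ρ ((if p.2 = q ∧ p.1 q.1.1 = 0 ∧ p.1 q.1.2 = 0 then z else 1) *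
        plaquetteHolonomy U p.1 p.2.1.1 p.2.1.2)).trace.re) := by
  rw [Fintype.sum_prod_type (f := fun p : Plaquette 4 L =>
    ((N : ℝ) - (ρ ((if p.2 = q ∧ p.1 q.1.1 = 0 ∧ p.1 q.1.2 = 0 then z else 1) *
      plaquetteHolonomy U p.1 p.2.1.1 p.2.1.2)).trace.re))]
  refine Fintype.sum_equiv (finTorusSiteEquivSite L) _ _ fun x => ?_
  refine Finset.sum_congr rfl fun q' _ => ?_
  have hiff : (q'.1.1 = q.1.1 ∧ q'.1.2 = q.1.2) ↔ q' = q := by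
    rw [Subtype.ext_iff, Prod.ext_iff]
  simp only [finTorusPlaquette_comp_site, tHooftTwistTensor_planeTwistTensor, hiff,
    finTorusSiteEquivSite_apply_eq_zero_iff]

/-- ★ **Equal sides give back the symmetric-torus twisted partition function**:
`twistedPartitionFunctionAniso ρ β L L z q = twistedPartitionFunction ρ β L z q` for every `L ≥ 1`, every compact `G`,
every `ρ`, `β`, `z` and plane `q` (the link reindexing `finTorusConfigEquivSite` along `Fin L ≃ ZMod L` preserves the
product Haar measure, matches the plaquette holonomies with their orientation and the stack `{x_μ = 0 = x_ν}` with
itself). [cite: Greensite2011, §4.4 (4.43)–(4.44)] [cite: MontvayMunster1994, §3.2.6 (3.145)] -/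
theorem twistedPartitionFunctionAniso_self (β : ℝ) (z : G) (q : {p : Fin 4 × Fin 4 // p.1 < p.2}) :
    twistedPartitionFunctionAniso ρ β L L z q = twistedPartitionFunction ρ β L z q := by
  rw [twistedPartitionFunction_def, twistedPartitionFunctionAniso_def, wilsonFinTorusTensorTwistedPartition_def,
    wilsonFinTorusPlaqTwistedPartition,
    ← (measurePreserving_finTorusConfigEquivSite (G := G) (L := L)).integral_comp']
  refine integral_congr_ae (Filter.Eventually.of_forall fun U => ?_)
  dsimp only
  rw [coe_finTorusConfigEquivSite, sum_twisted_finTorusPlaquette_comp_site, neg_mul]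

/-- The same bridge read towards the anisotropic side: at equal sides the symmetric-torus vortex data are values of the
two-parameter family `(L_s, L_t) ↦ twistedPartitionFunctionAniso ρ β L_s L_t z q` on the diagonal.
[cite: Greensite2011, §4.4 (4.43)–(4.44)] -/
theorem twistedPartitionFunction_eq_aniso (β : ℝ) (z : G) (q : {p : Fin 4 × Fin 4 // p.1 < p.2}) :
    twistedPartitionFunction ρ β L z q = twistedPartitionFunctionAniso ρ β L L z q :=
  (twistedPartitionFunctionAniso_self ρ β z q).symm

/-- At equal sides and a temporal plane the symmetric-torus twisted partition function is the temporally twisted `Fin`-box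
partition function (composition of the two bridges). [cite: tHooft1979Flux, §5 (5.3)] -/
theorem twistedPartitionFunction_eq_wilsonFinTorusTwistedPartition (β : ℝ) (z : G)
    (q : {p : Fin 4 × Fin 4 // p.1 < p.2}) (hq : q.1.2 = 3) :
    twistedPartitionFunction ρ β L z q = wilsonFinTorusTwistedPartition ρ β (Pi.mulSingle q.1.1 z) L L L L := by
  rw [twistedPartitionFunction_eq_aniso, twistedPartitionFunctionAniso_temporal ρ β L L z q hq]

end Symmetric

end Literature.MathematicalPhysics.QuantumFieldTheory

end
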